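/-
Copyright: the b2b-balaban T⁴-continuum CRUX team, row NE7b OWNER lineage `t4-ne7b-p1` (gen 139). Project licence.
-/
import Summits.QuantumFields.BalabanUV.T4Continuum.Spine.NE7b.SupDobrushinMassTransport
import Summits.QuantumFields.BalabanUV.T4Continuum.Spine.NE7b.SupCoordinateLipschitzClass

/-!
# DOBRUSHIN'S COVARIANCE ESTIMATE, ABSTRACT FORM (SCOPING (d10)(2)): let `μ` be a probability law on `ℝ^ι` with second moments and
# `P_x` (`x ∈ ι`) a family of operators on observables such that, on the coordinate-Lipschitz class of (441),
#   (P1) `P_x` maps a member with vector `a` to a member with vector `A_x a` ((440)'s update, `C ≥ 0`, `C_{xx} = 0`, rows `≤ γ < 1`),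
#   (P2) `∫P_xF dμ = ∫F dμ` (invariance),
#   (P3) `|∫FG dμ − ∫(P_xF)(P_xG) dμ| ≤ a_x·b_x∕c_x` (the one-step covariance loss; `c > 0`).
# THEN for members `F, G` with vectors `a, b` and every nonnegative `D` with `I + D·C ≤ D`,
#   `|∫FG dμ − ∫F dμ·∫G dμ| ≤ Σ_w (Dᵀa)_w·(Dᵀb)_w ∕ c_w`
# — Föllmer's covariance estimate in kernel letters; the single-site Gibbs sampler of a log-concave density with row-diagonally dominant
# Hessian kernel satisfies (P1)–(P3) ((443)–(446)) (row NE7b, node U5c; (440), (441) BY NAME; [folklore] — Dobrushin 1970, Föllmer 1982)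

Cell `pub-balaban`, sub-cell `t4`, spine estimate NE7b (`T4WeightBudget.RelWeightBound`; the cell's OWN estimate — NOT PRINTED in
[Bałaban 1983–89], NOT PROVED).  Crux-route work under `Spine/NE7b/` by the row OWNER (`t4-ne7b-p1` gen 139, file (442)) under FREEZE
(0)'s crux-prover clause; NOTHING of Bałaban's is named as a Lean object, valued or asserted; no `T4Continuum/Support` leaf typed; no
`def`, no notation (`P`, `A`, `Ψ` are hypothesis-characterised variables); zero `sorry`.  Imports (BY NAME): the OWNER's (440)
`…SupDobrushinMassTransport` (`bisum_fst`, `bisum_snd`, `bisum_le`, `traj_fst`, `traj_nonneg`, `sweeps_total_tendsto_zero`), (441)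
`…SupCoordinateLipschitzClass` (`abs_cov_le`, `lipVec_nonneg`).

THE ARGUMENT ([Föllmer, École d'Été de Probabilités de Saint-Flour XV–XVII, LNM 1362 (1988), Thm (2.13)∕(2.23)], in the Gibbs-sampler
form).  Along an update sequence `x₁, …, x_n` put `f_k = P_{x_k}f_{k−1}`, `g_k = P_{x_k}g_{k−1}`.  By (P2), `Cov(f_{k−1},g_{k−1}) −
Cov(f_k,g_k) = ∫f_{k−1}g_{k−1} − ∫f_kg_k`, which (P3) bounds by `v^a_{k−1}(x_k)v^b_{k−1}(x_k)∕c_{x_k}` with the majorant vectors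
`v^a_k = A_{x_k}⋯A_{x_1}a` of (P1); (440) `bisum_le` bounds the sum of these losses by `Σ_w (Dᵀa)_w(Dᵀb)_w∕c_w` for EVERY sequence;
the remainder `|Cov(f_n,g_n)| ≤ 2M₂(Σv^a_n)(Σv^b_n)` ((441) `abs_cov_le`) tends to zero along `k` sweeps through all sites ((440)
`sweeps_total_tendsto_zero`, `γ < 1`).

WHAT IS PROVED ([folklore]):
* §1 `iterate_lipVec` (the iterate `f_n` is in the class with vector `v^a_n`), `iterate_integral` (`∫f_n = ∫F`).
* §2 **`telescope`** (`|Cov(F,G) − Cov(f_n,g_n)| ≤ S_n`, `S_n` (440)'s bilinear pre-update sum), `remainder_le`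
  (`|Cov(f_n,g_n)| ≤ 2M₂(Σ_wv^a_n(w))(Σ_wv^b_n(w))`).
* §3 THE END **`abs_cov_le_kernel`** (`|∫FG − ∫F∫G| ≤ Σ_w (Dᵀa)_w(Dᵀb)_w∕c_w`).
* §4 toy (kernel): the identity family `P_x = id` is NOT admissible unless `a_x b_x = 0` — (P3) is the content; no toy beyond `rfl` bookkeeping.

HONEST (what this is NOT).  Abstract in `P`; that the Gibbs sampler of `e^{−V}dω` satisfies (P1)–(P3) under row-diagonal dominance of the
Hessian kernel of `V` is (443)–(446); the road instance (447).  No decay RATE is extracted here (it is carried by the choice of `D`, e.g.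
exponentially weighted Neumann sums when `C` has finite range).  Scalar skeleton ((A3), NC-NE7b-α UNRULED); nothing of Bałaban's asserted.
BY-NAME EFFECT ON THE WALL: NONE.  NE7b NOT PRINTED ∕ NOT PROVED; spine PROVED 0∕9; rung (B)+1 — the programme's measures remain FINITE-torus
statements; NOT the mass gap, NOT Clay.  HONEST DEPENDENCY: continuum YM on T⁴ ⇐ BetaPertH ∧ nine spine estimates (0∕9 proved); BetaPertH ⇐
(D1) ∧ (D4) ∧ CAP+tail; G-an2-4 gates asym, D1 and NE2∕3∕4.
-/

set_option autoImplicit false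

noncomputable section

namespace Summit.QuantumFields.BalabanUV.T4Continuum.NE7b.SupDobrushinCovarianceAbstract

open MeasureTheory Finset Function Filter Topology
open scoped BigOperators
open SupDobrushinMassTransport (bisum_fst bisum_snd bisum_le traj_fst traj_nonneg sweeps_total_tendsto_zero)
open SupCoordinateLipschitzClass (abs_cov_le lipVec_nonneg)

variable {ι : Type} [Fintype ι] [DecidableEq ι]

variable {μ : Measure (ι → ℝ)} {M₂ : ℝ} {C D : ι → ι → ℝ} {c : ι → ℝ} {γ : ℝ}
  {P : ι → ((ι → ℝ) → ℝ) → ((ι → ℝ) → ℝ)} {A : ι → (ι → ℝ) → (ι → ℝ)}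
  {Ψ : ι → (ι → ℝ) × (ι → ℝ) × ℝ → (ι → ℝ) × (ι → ℝ) × ℝ}

/-! ## §1. The iterates stay in the class, with the majorant vectors, and keep their means -/

omit [Fintype ι] in
/-- **The iterate `f_n = P_{x_n}⋯P_{x_1}F` is in the class with vector `v^a_n = A_{x_n}⋯A_{x_1}a`** ((P1) along the sequence). [folklore] -/
theorem iterate_lipVec
    (hP1 : ∀ (x : ι) (F : (ι → ℝ) → ℝ) (a : ι → ℝ), (∀ z ω s t, |F (update ω z s) - F (update ω z t)| ≤ a z * |s - t|) →
      ∀ z ω s t, |P x F (update ω z s) - P x F (update ω z t)| ≤ A x a z * |s - t|)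
    (xs : List ι) {F : (ι → ℝ) → ℝ} {a : ι → ℝ} (hF : ∀ z ω s t, |F (update ω z s) - F (update ω z t)| ≤ a z * |s - t|)
    (z : ι) (ω : ι → ℝ) (s t : ℝ) :
    |xs.foldl (fun f x => P x f) F (update ω z s) - xs.foldl (fun f x => P x f) F (update ω z t)| ≤
      xs.foldl (fun v x => A x v) a z * |s - t| := by
  induction xs using List.reverseRecOn generalizing z ω s t with
  | nil => exact hF z ω s t
  | append_singleton xs x ih =>
    rw [List.foldl_append, List.foldl_cons, List.foldl_nil, List.foldl_append, List.foldl_cons, List.foldl_nil]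
    exact hP1 x _ _ ih z ω s t

omit [Fintype ι] in
/-- **The iterates keep the mean**: `∫f_n dμ = ∫F dμ` ((P2) along the sequence). [folklore] -/
theorem iterate_integral
    (hP1 : ∀ (x : ι) (F : (ι → ℝ) → ℝ) (a : ι → ℝ), (∀ z ω s t, |F (update ω z s) - F (update ω z t)| ≤ a z * |s - t|) →
      ∀ z ω s t, |P x F (update ω z s) - P x F (update ω z t)| ≤ A x a z * |s - t|)
    (hP2 : ∀ (x : ι) (F : (ι → ℝ) → ℝ) (a : ι → ℝ), (∀ z ω s t, |F (update ω z s) - F (update ω z t)| ≤ a z * |s - t|) →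
      ∫ ω, P x F ω ∂μ = ∫ ω, F ω ∂μ)
    (xs : List ι) {F : (ι → ℝ) → ℝ} {a : ι → ℝ} (hF : ∀ z ω s t, |F (update ω z s) - F (update ω z t)| ≤ a z * |s - t|) :
    ∫ ω, xs.foldl (fun f x => P x f) F ω ∂μ = ∫ ω, F ω ∂μ := by
  induction xs using List.reverseRecOn with
  | nil => rfl
  | append_singleton xs x ih =>
    rw [← ih, List.foldl_append, List.foldl_cons, List.foldl_nil]
    exact hP2 x _ _ (iterate_lipVec hP1 xs hF)

/-! ## §2. The telescoping and the remainder -/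

omit [Fintype ι] in
/-- **THE TELESCOPING**: `|Cov(F,G) − Cov(f_n,g_n)| ≤ S_n`, where `S_n = Σ_k v^a_{k−1}(x_k)v^b_{k−1}(x_k)∕c_{x_k}` is (440)'s bilinear
pre-update sum (the fold of `Ψ_x(u,v,S) = (A_xu, A_xv, S + u_xv_x∕c_x)` from `(a, b, 0)`). [folklore] -/
theorem telescope
    (hΨ : ∀ x q, Ψ x q = (A x q.1, A x q.2.1, q.2.2 + q.1 x * q.2.1 x / c x))
    (hP1 : ∀ (x : ι) (F : (ι → ℝ) → ℝ) (a : ι → ℝ), (∀ z ω s t, |F (update ω z s) - F (update ω z t)| ≤ a z * |s - t|) →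
      ∀ z ω s t, |P x F (update ω z s) - P x F (update ω z t)| ≤ A x a z * |s - t|)
    (hP2 : ∀ (x : ι) (F : (ι → ℝ) → ℝ) (a : ι → ℝ), (∀ z ω s t, |F (update ω z s) - F (update ω z t)| ≤ a z * |s - t|) →
      ∫ ω, P x F ω ∂μ = ∫ ω, F ω ∂μ)
    (hP3 : ∀ (x : ι) (F G : (ι → ℝ) → ℝ) (a b : ι → ℝ), (∀ z ω s t, |F (update ω z s) - F (update ω z t)| ≤ a z * |s - t|) →
      (∀ z ω s t, |G (update ω z s) - G (update ω z t)| ≤ b z * |s - t|) →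
      |∫ ω, F ω * G ω ∂μ - ∫ ω, P x F ω * P x G ω ∂μ| ≤ a x * b x / c x)
    (xs : List ι) {F G : (ι → ℝ) → ℝ} {a b : ι → ℝ} (hF : ∀ z ω s t, |F (update ω z s) - F (update ω z t)| ≤ a z * |s - t|)
    (hG : ∀ z ω s t, |G (update ω z s) - G (update ω z t)| ≤ b z * |s - t|) :
    |(∫ ω, F ω * G ω ∂μ - (∫ ω, F ω ∂μ) * (∫ ω, G ω ∂μ)) -
        (∫ ω, xs.foldl (fun f x => P x f) F ω * xs.foldl (fun f x => P x f) G ω ∂μ -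
          (∫ ω, xs.foldl (fun f x => P x f) F ω ∂μ) * (∫ ω, xs.foldl (fun f x => P x f) G ω ∂μ))| ≤
      (xs.foldl (fun q x => Ψ x q) (a, b, 0)).2.2 := by
  induction xs using List.reverseRecOn with
  | nil => simp
  | append_singleton xs x ih =>
    -- the data after `n` steps
    set fn := xs.foldl (fun f x => P x f) F with hfn
    set gn := xs.foldl (fun f x => P x f) G with hgn
    have hfnL := iterate_lipVec hP1 xs hF
    have hgnL := iterate_lipVec hP1 xs hG
    rw [← hfn] at hfnL
    rw [← hgn] at hgnL
    have hq1 : (xs.foldl (fun q x => Ψ x q) (a, b, 0)).1 = xs.foldl (fun v x => A x v) a := bisum_fst hΨ xs a b 0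
    have hq2 : (xs.foldl (fun q x => Ψ x q) (a, b, 0)).2.1 = xs.foldl (fun v x => A x v) b := bisum_snd hΨ xs a b 0
    rw [List.foldl_append, List.foldl_cons, List.foldl_nil, List.foldl_append, List.foldl_cons, List.foldl_nil, List.foldl_append,
      List.foldl_cons, List.foldl_nil, hΨ, ← hfn, ← hgn]
    set q := xs.foldl (fun q x => Ψ x q) (a, b, 0) with hq
    dsimp only
    rw [hq1, hq2]
    -- the means do not move; the one-step loss
    have hmF : ∫ ω, P x fn ω ∂μ = ∫ ω, fn ω ∂μ := hP2 x fn _ hfnL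
    have hmG : ∫ ω, P x gn ω ∂μ = ∫ ω, gn ω ∂μ := hP2 x gn _ hgnL
    have hstep := hP3 x fn gn _ _ hfnL hgnL
    rw [hmF, hmG]
    calc |(∫ ω, F ω * G ω ∂μ - (∫ ω, F ω ∂μ) * (∫ ω, G ω ∂μ)) -
          (∫ ω, P x fn ω * P x gn ω ∂μ - (∫ ω, fn ω ∂μ) * (∫ ω, gn ω ∂μ))|
        = |((∫ ω, F ω * G ω ∂μ - (∫ ω, F ω ∂μ) * (∫ ω, G ω ∂μ)) - (∫ ω, fn ω * gn ω ∂μ - (∫ ω, fn ω ∂μ) * (∫ ω, gn ω ∂μ))) +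
            (∫ ω, fn ω * gn ω ∂μ - ∫ ω, P x fn ω * P x gn ω ∂μ)| := by ring_nf
      _ ≤ |(∫ ω, F ω * G ω ∂μ - (∫ ω, F ω ∂μ) * (∫ ω, G ω ∂μ)) - (∫ ω, fn ω * gn ω ∂μ - (∫ ω, fn ω ∂μ) * (∫ ω, gn ω ∂μ))| +
            |∫ ω, fn ω * gn ω ∂μ - ∫ ω, P x fn ω * P x gn ω ∂μ| := abs_add_le _ _
      _ ≤ q.2.2 + xs.foldl (fun v x => A x v) a x * xs.foldl (fun v x => A x v) b x / c x := add_le_add ih hstep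

/-- **The remainder**: `|Cov(f_n,g_n)| ≤ 2M₂·(Σ_w v^a_n(w))·(Σ_w v^b_n(w))` (by (441) `abs_cov_le` for the iterates). [folklore] -/
theorem remainder_le [IsProbabilityMeasure μ]
    (hP1 : ∀ (x : ι) (F : (ι → ℝ) → ℝ) (a : ι → ℝ), (∀ z ω s t, |F (update ω z s) - F (update ω z t)| ≤ a z * |s - t|) →
      ∀ z ω s t, |P x F (update ω z s) - P x F (update ω z t)| ≤ A x a z * |s - t|)
    (hμ2 : ∀ z, MemLp (fun ω : ι → ℝ => ω z) 2 μ) (hM : ∀ z, ∫ ω, ω z ^ 2 ∂μ ≤ M₂)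
    (xs : List ι) {F G : (ι → ℝ) → ℝ} {a b : ι → ℝ} (hF : ∀ z ω s t, |F (update ω z s) - F (update ω z t)| ≤ a z * |s - t|)
    (hG : ∀ z ω s t, |G (update ω z s) - G (update ω z t)| ≤ b z * |s - t|) :
    |∫ ω, xs.foldl (fun f x => P x f) F ω * xs.foldl (fun f x => P x f) G ω ∂μ -
        (∫ ω, xs.foldl (fun f x => P x f) F ω ∂μ) * (∫ ω, xs.foldl (fun f x => P x f) G ω ∂μ)| ≤
      2 * M₂ * (∑ w, xs.foldl (fun v x => A x v) a w) * (∑ w, xs.foldl (fun v x => A x v) b w) :=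
  abs_cov_le (iterate_lipVec hP1 xs hF) (iterate_lipVec hP1 xs hG) hμ2 hM

/-! ## §3. The covariance estimate -/

/-- **DOBRUSHIN'S COVARIANCE ESTIMATE, ABSTRACT FORM**: for a probability law `μ` on `ℝ^ι` with `∫ω_z² ≤ M₂` and operators `P_x`
satisfying (P1) Lipschitz propagation with (440)'s update (`C ≥ 0`, `C_{xx} = 0`, `Σ_zC_{xz} ≤ γ < 1`), (P2) invariance and (P3) the one-step
loss `a_xb_x∕c_x` (`c > 0`), two members `F, G` of the class with vectors `a, b` satisfy, for every nonnegative `D` with `I + D·C ≤ D`,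
`|∫FG dμ − ∫F dμ·∫G dμ| ≤ Σ_w (Σ_zD_{zw}a_z)(Σ_zD_{zw}b_z)∕c_w`. [folklore: Föllmer 1982 ∕ LNM 1362 Thm (2.23)] -/
theorem abs_cov_le_kernel [IsProbabilityMeasure μ]
    (hA : ∀ x v z, A x v z = if z = x then 0 else v z + C x z * v x) (hC : ∀ x z, 0 ≤ C x z) (hC0 : ∀ x, C x x = 0)
    (hrow : ∀ x, ∑ z, C x z ≤ γ) (hγ0 : 0 ≤ γ) (hγ1 : γ < 1) (hc : ∀ x, 0 < c x) (hD : ∀ x y, 0 ≤ D x y)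
    (hDC : ∀ x y, (if x = y then (1 : ℝ) else 0) + ∑ z, D x z * C z y ≤ D x y)
    (hμ2 : ∀ z, MemLp (fun ω : ι → ℝ => ω z) 2 μ) (hM : ∀ z, ∫ ω, ω z ^ 2 ∂μ ≤ M₂)
    (hP1 : ∀ (x : ι) (F : (ι → ℝ) → ℝ) (a : ι → ℝ), (∀ z ω s t, |F (update ω z s) - F (update ω z t)| ≤ a z * |s - t|) →
      ∀ z ω s t, |P x F (update ω z s) - P x F (update ω z t)| ≤ A x a z * |s - t|)
    (hP2 : ∀ (x : ι) (F : (ι → ℝ) → ℝ) (a : ι → ℝ), (∀ z ω s t, |F (update ω z s) - F (update ω z t)| ≤ a z * |s - t|) →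
      ∫ ω, P x F ω ∂μ = ∫ ω, F ω ∂μ)
    (hP3 : ∀ (x : ι) (F G : (ι → ℝ) → ℝ) (a b : ι → ℝ), (∀ z ω s t, |F (update ω z s) - F (update ω z t)| ≤ a z * |s - t|) →
      (∀ z ω s t, |G (update ω z s) - G (update ω z t)| ≤ b z * |s - t|) →
      |∫ ω, F ω * G ω ∂μ - ∫ ω, P x F ω * P x G ω ∂μ| ≤ a x * b x / c x)
    {F G : (ι → ℝ) → ℝ} {a b : ι → ℝ} (hF : ∀ z ω s t, |F (update ω z s) - F (update ω z t)| ≤ a z * |s - t|)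
    (hG : ∀ z ω s t, |G (update ω z s) - G (update ω z t)| ≤ b z * |s - t|) :
    |∫ ω, F ω * G ω ∂μ - (∫ ω, F ω ∂μ) * (∫ ω, G ω ∂μ)| ≤ ∑ w, (∑ z, D z w * a z) * (∑ z, D z w * b z) / c w := by
  have ha : ∀ z, 0 ≤ a z := lipVec_nonneg hF
  have hb : ∀ z, 0 ≤ b z := lipVec_nonneg hG
  -- the triple update, written out once
  have hΨ : ∀ (x : ι) (q : (ι → ℝ) × (ι → ℝ) × ℝ), (fun (x : ι) (q : (ι → ℝ) × (ι → ℝ) × ℝ) =>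
      ((A x q.1, A x q.2.1, q.2.2 + q.1 x * q.2.1 x / c x) : (ι → ℝ) × (ι → ℝ) × ℝ)) x q =
      (A x q.1, A x q.2.1, q.2.2 + q.1 x * q.2.1 x / c x) := fun _ _ => rfl
  -- one sweep through all sites, repeated `k` times
  set L : List ι := Finset.univ.toList with hL
  have hLall : ∀ w, w ∈ L := fun w => by rw [hL, Finset.mem_toList]; exact Finset.mem_univ w
  set B : ℝ := ∑ w, (∑ z, D z w * a z) * (∑ z, D z w * b z) / c w with hB
  -- for every `k`: `|Cov| ≤ B + 2M₂(Σv^a_k)(Σv^b_k)`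
  have hk : ∀ k : ℕ, |∫ ω, F ω * G ω ∂μ - (∫ ω, F ω ∂μ) * (∫ ω, G ω ∂μ)| ≤
      B + 2 * M₂ * (∑ w, (List.replicate k L).flatten.foldl (fun v x => A x v) a w) *
        (∑ w, (List.replicate k L).flatten.foldl (fun v x => A x v) b w) := by
    intro k
    set xs := (List.replicate k L).flatten with hxs
    have h1 := telescope hΨ hP1 hP2 hP3 xs hF hG
    have h2 := remainder_le hP1 hμ2 hM xs hF hG
    have h3 : (xs.foldl (fun q x => (fun (x : ι) (q : (ι → ℝ) × (ι → ℝ) × ℝ) =>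
        ((A x q.1, A x q.2.1, q.2.2 + q.1 x * q.2.1 x / c x) : (ι → ℝ) × (ι → ℝ) × ℝ)) x q) (a, b, 0)).2.2 ≤ B :=
      bisum_le hA hΨ hC hC0 hD hDC hc xs ha hb
    have := abs_sub_abs_le_abs_sub (∫ ω, F ω * G ω ∂μ - (∫ ω, F ω ∂μ) * (∫ ω, G ω ∂μ))
      (∫ ω, xs.foldl (fun f x => P x f) F ω * xs.foldl (fun f x => P x f) G ω ∂μ -
        (∫ ω, xs.foldl (fun f x => P x f) F ω ∂μ) * (∫ ω, xs.foldl (fun f x => P x f) G ω ∂μ))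
    linarith
  -- the remainder tends to zero
  have hta := sweeps_total_tendsto_zero hA hC hC0 hrow hγ0 hγ1 hLall ha
  have htb := sweeps_total_tendsto_zero hA hC hC0 hrow hγ0 hγ1 hLall hb
  have hlim : Tendsto (fun k : ℕ => B + 2 * M₂ * (∑ w, (List.replicate k L).flatten.foldl (fun v x => A x v) a w) *
      (∑ w, (List.replicate k L).flatten.foldl (fun v x => A x v) b w)) atTop (𝓝 B) := by
    have h := ((hta.const_mul (2 * M₂)).mul htb).const_add B
    simpa using h
  exact ge_of_tendsto' hlim hk

end Summit.QuantumFields.BalabanUV.T4Continuum.NE7b.SupDobrushinCovarianceAbstract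

end
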